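import Mathlib.Algebra.Lie.UniversalEnveloping
import Mathlib.Algebra.Lie.OfAssociative
import Mathlib.Algebra.Lie.Subalgebra
import Mathlib.Analysis.RCLike.Basic
import Mathlib.LinearAlgebra.Complex.Module
import Mathlib.RingTheory.MvPolynomial.Symmetric.Defs
import Mathlib.RingTheory.TensorProduct.Basic
import Mathlib.Logic.Equiv.Prod
import Literature.NumberTheory.Automorphic.GKModules
import HarnessLib

-- provenance: harness21/H21/H21/Prelude/AutomorphicL/HarishChandraGL.lean @ fc9edfb (interim HEAD d8f2665); M5 mechanical rewrite
/-!
# The Harish-Chandra homomorphism for `𝔤𝔩ₙ(𝕜)`, `𝕜 = ℝ` or `ℂ`, and Harish-Chandra parameters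

Trunk: AutomorphicL (prelude, item I10 `HarishChandraGL`; notion `archimedean_gK_module`;
design D3, review 4).

Let `𝕜` be `ℝ` or `ℂ` (`[RCLike 𝕜]`) and `𝔤 = 𝔤𝔩ₙ(𝕜) = Matrix (Fin n) (Fin n) 𝕜`, regarded as a
*real* Lie algebra (commutator bracket). Its complexification is
`𝔤_ℂ = ⨁_{τ : 𝕜 →ₐ[ℝ] ℂ} 𝔤𝔩ₙ(ℂ)` (one copy for `𝕜 = ℝ`, two copies — `id` and complex
conjugation — for `𝕜 = ℂ`), with diagonal Cartan subalgebra `𝔥_ℂ = ⨁_τ ℂⁿ` and Weyl group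
`∏_τ 𝔖ₙ`. Harish-Chandra's theorem (Knapp, *Lie Groups Beyond an Introduction*, Thm. 5.44)
gives an algebra isomorphism `γ : Z(𝔤_ℂ) ≃ S(𝔥_ℂ)^W = ℂ[x_{τ,i}]^{∏ 𝔖ₙ}`, characterised by:
`z ∈ Z(𝔤_ℂ)` acts on any highest weight vector of highest weight `λ ∈ 𝔥_ℂ^*` by the scalar
`γ(z)(λ + ρ)`, `ρ = ((n-1)/2, (n-3)/2, …, -(n-1)/2)` in each factor `τ`.

Following D3 (no complexification of `𝔤` in Lean) we work with the *real* enveloping algebra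
`U(𝔤) = UniversalEnvelopingAlgebra ℝ 𝔤`, whose centre satisfies `Z(𝔤_ℂ) = ℂ ⊗_ℝ Z(𝔤)`, and
record `γ|_{Z(𝔤)}` as a **hypothesis structure** `HarishChandraHomGL 𝕜 n`: a real algebra map
`Z(𝔤) →ₐ[ℝ] MvPolynomial ((𝕜 →ₐ[ℝ] ℂ) × Fin n) ℂ` with `τ`-wise symmetric values, *pinned down*
by the highest-weight axiom. Existence and uniqueness are (sorried) theorems. The archimedean
(Harish-Chandra, Langlands) parameter of a `𝔤`-module with infinitesimal character `θ` is then the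
family of multisets `χ τ = {x_{τ,1}, …, x_{τ,n}}` with `θ = ev_x ∘ γ` (Clozel 1990, §3;
Buzzard–Gee 2014, §3.1 and §5).

## Main definitions

* `Literature.Automorphic.diagLie 𝕜 n`, `Literature.Automorphic.upperNilpLie 𝕜 n` — the diagonal and strictly
  upper triangular real Lie subalgebras of `𝔤𝔩ₙ(𝕜)`.
* `Literature.Automorphic.ArchWeightGL 𝕜 n = (𝕜 →ₐ[ℝ] ℂ) → Fin n → ℂ` — weights of `𝔥_ℂ`;
  `weightFun l h = ∑ τ i, l τ i * τ (h i)` — the value of the weight `l` on `diag(h) ∈ 𝔥 ⊆ 𝔤`.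
* `Literature.Automorphic.IsHighestWeightVector ρ𝔤 l v`, `Literature.Automorphic.rhoGL n`.
* `Literature.Automorphic.HarishChandraHomGL 𝕜 n` — the Harish-Chandra homomorphism (hypothesis structure);
  `Literature.Automorphic.symmetricSubalgebraGL 𝕜 n` — the `τ`-wise symmetric polynomials.
* `Literature.Automorphic.HasCentralCharacter ρ θ` — `Z(L)` acts through `θ : Z(L) →ₐ[ℝ] ℂ`, for any real
  Lie algebra `L` acting on a complex vector space (restating `HasInfinitesimalCharacter` of
  `Literature.Prelude.AutomorphicL.GKModules`, which is the special case `L = G.lie`; see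
  `hasInfinitesimalCharacter_iff_hasCentralCharacter`).
* `Literature.Automorphic.HasHCParameter ρ𝔤 χ` — the `𝔤𝔩ₙ(𝕜)`-module `ρ𝔤` has Harish-Chandra parameter
  `χ : (𝕜 →ₐ[ℝ] ℂ) → Multiset ℂ`.

## Main statements (sorried, known in print)

* `nonempty_harishChandraHomGL`, `harishChandraHomGL_unique`,
  `harishChandraHomGL_bijective_symmetric` — Harish-Chandra's theorem, Knapp Thm. 5.44
  (with Verma modules, Knapp §V.3, for uniqueness).
* `hasHCParameter_trivial` — the trivial representation has parameter `ρ` (Knapp, (5.43) ff.).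

## Design notes

* (H1) The Lie bracket on `Matrix (Fin n) (Fin n) 𝕜` and on `Module.End ℂ V` is the commutator,
  via Mathlib's idiom `attribute [local instance 100] LieRing.ofAssociativeRing`; the real module
  structure on a complex space `V` is Mathlib's `Module.complexToReal`.
* (H9) `HarishChandraHomGL.highestWeight` quantifies over `V : Type`.
* `Fintype (𝕜 →ₐ[ℝ] ℂ)` is found by instance search (`FiniteDimensional ℝ 𝕜`).
* Worker's choice for `HasHCParameter` (outline I10): the infinitesimal-character predicate is
  *restated* for an arbitrary real Lie algebra (`HasCentralCharacter`) rather than transported from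
  `GKModules.HasInfinitesimalCharacter` along `LieSubalgebra.topEquiv`; the two agree
  definitionally on `G.lie` (`hasInfinitesimalCharacter_iff_hasCentralCharacter`).
* Mathlib has `MvPolynomial.symmetricSubalgebra` (invariants of *all* permutations of the
  variables) but not the invariants of the Young subgroup `∏_τ 𝔖ₙ`; it has
  `UniversalEnvelopingAlgebra`, `Subalgebra.center`, `LinearMap.liftBaseChange`, but no
  Harish-Chandra homomorphism, Verma modules or highest weight theory for `𝔤𝔩ₙ`.
* No algebraicity / regularity predicates on parameters are defined here (review 4): those are
  expressed downstream with G19's `InfinityType`.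

## References

* A. W. Knapp, *Lie Groups Beyond an Introduction*, 2nd ed., Birkhäuser 2002, §V.3–V.5, Thm. 5.44.
* L. Clozel, *Motifs et formes automorphes*, in: Automorphic forms, Shimura varieties, and
  L-functions I, Academic Press 1990, §3.
* K. Buzzard, T. Gee, *The conjectural connections between automorphic representations and Galois
  representations*, LMS Lecture Notes 414 (2014), §3.1, §5.
-/

-- Mathlib idiom (Mathlib/Algebra/Lie/OfAssociative.lean); needed to mention Lie subalgebras of matrix algebras
attribute [local instance 100] LieRing.ofAssociativeRing

open scoped Matrix TensorProduct

noncomputable section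

namespace Literature.NumberTheory.Automorphic

/-! ## Infinitesimal (central) characters for a real Lie algebra acting on a complex space -/

section CentralCharacter

variable {L : Type*} [LieRing L] [LieAlgebra ℝ L] {V : Type*} [AddCommGroup V] [Module ℂ V]
  (ρ : L →ₗ⁅ℝ⁆ Module.End ℂ V)

/-- `ρ` has *infinitesimal (central) character* `θ : Z(L) →ₐ[ℝ] ℂ`: every element `z` of the
centre `Z(L)` of the real enveloping algebra `U(L)` acts on `V` (through
`UniversalEnvelopingAlgebra.lift ℝ ρ`) by the scalar `θ z`. This restates
`Literature.NumberTheory.Automorphic.HasInfinitesimalCharacter` (file `GKModules`, case `L = G.lie`) for an arbitrary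
real Lie algebra. Knapp–Vogan, *Cohomological Induction*, §I.4, (4.113)–(4.114);
Knapp, *Lie Groups Beyond an Introduction*, §V.4. [folklore] -/
def HasCentralCharacter
    (θ : Subalgebra.center ℝ (UniversalEnvelopingAlgebra ℝ L) →ₐ[ℝ] ℂ) : Prop :=
  ∀ z : Subalgebra.center ℝ (UniversalEnvelopingAlgebra ℝ L),
    UniversalEnvelopingAlgebra.lift ℝ ρ (z : UniversalEnvelopingAlgebra ℝ L) =
      algebraMap ℂ (Module.End ℂ V) (θ z)

end CentralCharacter

section Bridge

variable {A : Type*} [NormedCommRing A] [NormedAlgebra ℝ A] [NormedAlgebra ℚ A] [CompleteSpace A]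
  [StarRing A] {N : Type*} [Fintype N] [DecidableEq N] {G : RealMatrixGroup A N}
  {V : Type*} [AddCommGroup V] [Module ℂ V] (ρ𝔤 : G.lie →ₗ⁅ℝ⁆ Module.End ℂ V)

/-- For the Lie algebra `𝔤 = G.lie` of a linear real group, `HasInfinitesimalCharacter`
(`GKModules`) and `HasCentralCharacter` agree (definitionally). Knapp–Vogan, §I.4, (4.113). [folklore] -/
theorem hasInfinitesimalCharacter_iff_hasCentralCharacter (θ : centerU G →ₐ[ℝ] ℂ) :
    HasInfinitesimalCharacter ρ𝔤 θ ↔ HasCentralCharacter ρ𝔤 θ :=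
  Iff.rfl

end Bridge

/-! ## `𝔤𝔩ₙ(𝕜)` as a real Lie algebra: Cartan and nilpotent subalgebras, weights -/

section GLn

variable (𝕜 : Type*) [RCLike 𝕜] (n : ℕ)

/-- The diagonal subalgebra `𝔥 = {diag(h) | h : Fin n → 𝕜}` of `𝔤𝔩ₙ(𝕜)` (a real Lie
subalgebra; abelian). Knapp, *Lie Groups Beyond an Introduction*, §II.1, Example 1 and §V.5. [folklore] -/
def diagLie : LieSubalgebra ℝ (Matrix (Fin n) (Fin n) 𝕜) where
  carrier := Set.range (Matrix.diagonal : (Fin n → 𝕜) → Matrix (Fin n) (Fin n) 𝕜)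
  zero_mem' := ⟨0, Matrix.diagonal_zero⟩
  add_mem' := by
    rintro _ _ ⟨a, rfl⟩ ⟨b, rfl⟩
    exact ⟨a + b, (Matrix.diagonal_add a b).symm⟩
  smul_mem' := by
    rintro c _ ⟨a, rfl⟩
    exact ⟨c • a, Matrix.diagonal_smul c a⟩
  lie_mem' := by
    rintro _ _ ⟨a, rfl⟩ ⟨b, rfl⟩
    refine ⟨a * b - b * a, ?_⟩
    rw [Ring.lie_def, Matrix.diagonal_mul_diagonal, Matrix.diagonal_mul_diagonal,
      Matrix.diagonal_sub]
    rfl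

/-- Membership in the diagonal subalgebra. Knapp, §II.1, Example 1. [folklore] -/
theorem mem_diagLie_iff (X : Matrix (Fin n) (Fin n) 𝕜) :
    X ∈ diagLie 𝕜 n ↔ ∃ h : Fin n → 𝕜, Matrix.diagonal h = X :=
  Iff.rfl

/-- The strictly upper triangular subalgebra `𝔫 = {X | X i j = 0 for j ≤ i}` of `𝔤𝔩ₙ(𝕜)`
(a real Lie subalgebra; the nilradical of the upper triangular Borel subalgebra).
Knapp, *Lie Groups Beyond an Introduction*, §II.1, Example 1 (positive roots `e_i - e_j`,
`i < j`) and §V.5. [folklore] -/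
def upperNilpLie : LieSubalgebra ℝ (Matrix (Fin n) (Fin n) 𝕜) where
  carrier := {X | ∀ i j, j ≤ i → X i j = 0}
  zero_mem' _ _ _ := rfl
  add_mem' {X Y} hX hY i j hji := by
    simp only [Matrix.add_apply, hX i j hji, hY i j hji, add_zero]
  smul_mem' c {X} hX i j hji := by
    simp only [Matrix.smul_apply, hX i j hji, smul_zero]
  lie_mem' {X Y} hX hY i j hji := by
    have key : ∀ X Y : Matrix (Fin n) (Fin n) 𝕜, (∀ i j, j ≤ i → X i j = 0) →
        (∀ i j, j ≤ i → Y i j = 0) → (X * Y) i j = 0 := by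
      intro X Y hX hY
      rw [Matrix.mul_apply]
      refine Finset.sum_eq_zero fun k _ ↦ ?_
      rcases le_or_gt k i with h | h
      · rw [hX i k h, zero_mul]
      · rw [hY k j (hji.trans h.le), mul_zero]
    simp only [Set.mem_setOf_eq] at hX hY
    rw [Ring.lie_def, Matrix.sub_apply, key X Y hX hY, key Y X hY hX, sub_zero]

/-- Membership in the strictly upper triangular subalgebra. Knapp, §II.1, Example 1. [folklore] -/
theorem mem_upperNilpLie_iff (X : Matrix (Fin n) (Fin n) 𝕜) :
    X ∈ upperNilpLie 𝕜 n ↔ ∀ i j, j ≤ i → X i j = 0 :=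
  Iff.rfl

/-- Weights of the complexified Cartan subalgebra `𝔥_ℂ = ⨁_{τ : 𝕜 →ₐ[ℝ] ℂ} ℂⁿ` of `𝔤𝔩ₙ(𝕜)`:
a family of `n` complex numbers for each real-algebra embedding `τ : 𝕜 → ℂ` (one for `𝕜 = ℝ`,
two for `𝕜 = ℂ`). Knapp, §V.5 (with §VI.1 for complexifications); Clozel 1990, §3.3;
Buzzard–Gee 2014, §3.1. [cite: Clozel1990, §3.3] -/
abbrev ArchWeightGL : Type _ := (𝕜 →ₐ[ℝ] ℂ) → Fin n → ℂ

variable {𝕜 n}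

/-- The value `l(diag h) = ∑_τ ∑_i l τ i · τ(h i)` of the weight `l ∈ 𝔥_ℂ^*` on the real diagonal
matrix `diag(h) ∈ 𝔥 ⊆ 𝔤𝔩ₙ(𝕜)` (via `𝔥 ↪ 𝔥_ℂ = ⨁_τ ℂⁿ`, `h ↦ (τ ∘ h)_τ`).
Knapp, §V.5 and §VI.1; Clozel 1990, §3.3. [cite: Clozel1990, §3.3] -/
def weightFun (l : ArchWeightGL 𝕜 n) (h : Fin n → 𝕜) : ℂ :=
  ∑ τ : 𝕜 →ₐ[ℝ] ℂ, ∑ i : Fin n, l τ i * τ (h i)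

variable {V : Type*} [AddCommGroup V] [Module ℂ V]
  (ρ𝔤 : Matrix (Fin n) (Fin n) 𝕜 →ₗ⁅ℝ⁆ Module.End ℂ V)

/-- `v` is a *highest weight vector* of weight `l` for the real Lie algebra action `ρ𝔤` of
`𝔤𝔩ₙ(𝕜)` on the complex space `V` (equivalently, for the `ℂ`-linear extension of `ρ𝔤` to `𝔤_ℂ`,
with respect to the upper triangular Borel): `v ≠ 0`, `𝔫 · v = 0`, and `diag(h) · v = l(diag h) v`
for all `h`. Knapp, *Lie Groups Beyond an Introduction*, §V.2–V.3 (Thm. 5.5). [folklore] -/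
def IsHighestWeightVector (l : ArchWeightGL 𝕜 n) (v : V) : Prop :=
  v ≠ 0 ∧ (∀ X ∈ upperNilpLie 𝕜 n, ρ𝔤 X v = 0) ∧
    ∀ h : Fin n → 𝕜, ρ𝔤 (Matrix.diagonal h) v = weightFun l h • v

variable (n) in
/-- Half the sum of the positive roots of `𝔤𝔩ₙ`, in coordinates: `ρ_i = (n - 1)/2 - i`
(`i = 0, …, n-1`), i.e. `ρ = ((n-1)/2, (n-3)/2, …, -(n-1)/2)`. Knapp, §V.5, before Thm. 5.44
(`δ`); Buzzard–Gee 2014, §5. [cite: BuzzardGee2014, §5] -/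
def rhoGL : Fin n → ℂ := fun i ↦ ((n : ℂ) - 1) / 2 - ((i : ℕ) : ℂ)

/-! ## The Harish-Chandra homomorphism -/

variable (𝕜 n)

/-- The subalgebra `ℂ[x_{τ,i}]^{∏_τ 𝔖ₙ}` of polynomials in the variables `x_{τ,i}`
(`τ : 𝕜 →ₐ[ℝ] ℂ`, `i : Fin n`) invariant under all `τ`-wise permutations
`(τ, i) ↦ (τ, σ_τ i)` — the Weyl group invariants `S(𝔥_ℂ)^W` for `𝔤𝔩ₙ(𝕜)_ℂ = ∏_τ 𝔤𝔩ₙ(ℂ)`.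
(Mathlib's `MvPolynomial.symmetricSubalgebra` is the smaller algebra of invariants of *all*
permutations of `(𝕜 →ₐ[ℝ] ℂ) × Fin n`.) Knapp, *Lie Groups Beyond an Introduction*, §V.5,
Thm. 5.44. [folklore] -/
def symmetricSubalgebraGL : Subalgebra ℂ (MvPolynomial ((𝕜 →ₐ[ℝ] ℂ) × Fin n) ℂ) where
  carrier := {p | ∀ σ : (𝕜 →ₐ[ℝ] ℂ) → Equiv.Perm (Fin n),
    MvPolynomial.rename (Equiv.prodCongrRight σ) p = p}
  mul_mem' {p q} hp hq σ := by rw [map_mul, hp σ, hq σ]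
  add_mem' {p q} hp hq σ := by rw [map_add, hp σ, hq σ]
  algebraMap_mem' c σ := AlgHom.commutes _ c

variable {𝕜 n} in
/-- Membership in `symmetricSubalgebraGL`: invariance under `τ`-wise permutations of the
variables. Knapp, §V.5. [folklore] -/
theorem mem_symmetricSubalgebraGL_iff (p : MvPolynomial ((𝕜 →ₐ[ℝ] ℂ) × Fin n) ℂ) :
    p ∈ symmetricSubalgebraGL 𝕜 n ↔ ∀ σ : (𝕜 →ₐ[ℝ] ℂ) → Equiv.Perm (Fin n),
      MvPolynomial.rename (Equiv.prodCongrRight σ) p = p :=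
  Iff.rfl

/-- A **Harish-Chandra homomorphism** for `𝔤 = 𝔤𝔩ₙ(𝕜)` (hypothesis structure): a real algebra
map `γ : Z(𝔤) → ℂ[x_{τ,i}]` from the centre of the *real* enveloping algebra
`U(𝔤) = UniversalEnvelopingAlgebra ℝ 𝔤` (recall `Z(𝔤_ℂ) = ℂ ⊗_ℝ Z(𝔤)`) to polynomial functions
on `𝔥_ℂ^* = ∏_τ ℂⁿ`, with `τ`-wise symmetric values, such that every `z ∈ Z(𝔤)` acts on every
highest weight vector of weight `λ` (in every `𝔤`-module) by the scalar `γ(z)(λ + ρ)`.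
By Harish-Chandra's theorem such a `γ` exists, is unique, and `ℂ ⊗ γ` is an isomorphism onto
`ℂ[x_{τ,i}]^{∏ 𝔖ₙ}` (`nonempty_harishChandraHomGL`, `harishChandraHomGL_unique`,
`harishChandraHomGL_bijective_symmetric`). Knapp, *Lie Groups Beyond an Introduction*, §V.5,
Thm. 5.44 (`γ = τ_δ ∘ γ'ₙ`); Buzzard–Gee 2014, §3.1. [cite: BuzzardGee2014, §3.1] -/
structure HarishChandraHomGL where
  /-- The underlying real algebra homomorphism `Z(𝔤) →ₐ[ℝ] ℂ[x_{τ,i}]`. -/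
  toAlgHom : Subalgebra.center ℝ (UniversalEnvelopingAlgebra ℝ (Matrix (Fin n) (Fin n) 𝕜)) →ₐ[ℝ]
    MvPolynomial ((𝕜 →ₐ[ℝ] ℂ) × Fin n) ℂ
  /-- The values are invariant under the Weyl group `∏_τ 𝔖ₙ` (`τ`-wise permutations). -/
  symmetric : ∀ (σ : (𝕜 →ₐ[ℝ] ℂ) → Equiv.Perm (Fin n)) (z),
    MvPolynomial.rename (Equiv.prodCongrRight σ) (toAlgHom z) = toAlgHom z
  /-- The highest-weight normalisation: `z` acts on a highest weight vector of weight `λ` by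
  `γ(z)(λ + ρ)` (H9: `V : Type`). -/
  highestWeight : ∀ (V : Type) [AddCommGroup V] [Module ℂ V]
    (ρ𝔤 : Matrix (Fin n) (Fin n) 𝕜 →ₗ⁅ℝ⁆ Module.End ℂ V) (l : ArchWeightGL 𝕜 n) (v : V),
    IsHighestWeightVector ρ𝔤 l v →
      ∀ z : Subalgebra.center ℝ (UniversalEnvelopingAlgebra ℝ (Matrix (Fin n) (Fin n) 𝕜)),
        UniversalEnvelopingAlgebra.lift ℝ ρ𝔤
            (z : UniversalEnvelopingAlgebra ℝ (Matrix (Fin n) (Fin n) 𝕜)) v =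
          MvPolynomial.aeval (fun p : (𝕜 →ₐ[ℝ] ℂ) × Fin n ↦ l p.1 p.2 + rhoGL n p.2)
            (toAlgHom z) • v

variable {𝕜 n} in
/-- The values of a Harish-Chandra homomorphism lie in `ℂ[x_{τ,i}]^{∏ 𝔖ₙ}`. Knapp, Thm. 5.44. [folklore] -/
theorem HarishChandraHomGL.toAlgHom_mem_symmetricSubalgebraGL (γ : HarishChandraHomGL 𝕜 n)
    (z : Subalgebra.center ℝ (UniversalEnvelopingAlgebra ℝ (Matrix (Fin n) (Fin n) 𝕜))) :
    γ.toAlgHom z ∈ symmetricSubalgebraGL 𝕜 n :=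
  fun σ ↦ γ.symmetric σ z

/-- **Harish-Chandra's theorem (existence).** A Harish-Chandra homomorphism for `𝔤𝔩ₙ(𝕜)`
exists. Knapp, *Lie Groups Beyond an Introduction*, §V.5, Thm. 5.44 with Lemma 5.42 / (5.43)
(action on highest weight vectors) and §VI.1 (complexification `𝔤_ℂ = ∏_τ 𝔤𝔩ₙ(ℂ)`). [cite: Knapp2002, Thm. 5.44 with Lemma 5.42 / (5.43) and §VI.1] -/
def nonempty_harishChandraHomGL : Prop :=
  Nonempty (HarishChandraHomGL 𝕜 n)

variable {𝕜 n} in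
/-- **Harish-Chandra's theorem (uniqueness).** The Harish-Chandra homomorphism is determined by
its action on highest weight vectors: Verma modules of all highest weights `λ ∈ 𝔥_ℂ^*` exist
(Knapp, §V.3), and a polynomial on `𝔥_ℂ^*` is determined by its values.
Knapp, *Lie Groups Beyond an Introduction*, §V.3 and Thm. 5.44. [cite: Knapp2002, §V.3 and Thm. 5.44] -/
def harishChandraHomGL_unique : Prop :=
  ∀ (γ₁ γ₂ : HarishChandraHomGL 𝕜 n),
    γ₁ = γ₂

variable {𝕜 n} in
/-- **Harish-Chandra's theorem (isomorphism).** The `ℂ`-linear extension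
`ℂ ⊗_ℝ Z(𝔤) → ℂ[x_{τ,i}]` of the Harish-Chandra homomorphism is injective with image exactly the
`∏_τ 𝔖ₙ`-invariant polynomials, i.e. `γ_ℂ : Z(𝔤_ℂ) ≃ S(𝔥_ℂ)^W`.
Knapp, *Lie Groups Beyond an Introduction*, §V.5, Thm. 5.44. [cite: Knapp2002, §V.5 Thm. 5.44] -/
def harishChandraHomGL_bijective_symmetric : Prop :=
  ∀ (γ : HarishChandraHomGL 𝕜 n),
    Function.Injective (γ.toAlgHom.toLinearMap.liftBaseChange ℂ) ∧
      LinearMap.range (γ.toAlgHom.toLinearMap.liftBaseChange ℂ) =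
        Subalgebra.toSubmodule (symmetricSubalgebraGL 𝕜 n)

/-! ## Harish-Chandra parameters -/

variable {𝕜 n}

/-- The `𝔤𝔩ₙ(𝕜)`-module `(V, ρ𝔤)` has **Harish-Chandra (archimedean Langlands) parameter**
`χ : (𝕜 →ₐ[ℝ] ℂ) → Multiset ℂ`: each `χ τ` has `n` elements, and `ρ𝔤` has an infinitesimal
character `θ : Z(𝔤) →ₐ[ℝ] ℂ` which, for the Harish-Chandra homomorphism `γ` and any enumeration
`l τ : Fin n → ℂ` of `χ τ`, is evaluation of `γ z` at `x_{τ,i} = l τ i`: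
`θ z = γ(z)(l)`. (By `τ`-wise symmetry of `γ` this is independent of the enumeration; `γ` is
unique by `harishChandraHomGL_unique`, so quantifying over all `γ` is harmless.) A highest weight
module of highest weight `λ` has parameter `{λ_{τ,i} + ρ_i}`.
Clozel 1990, §3.3; Buzzard–Gee 2014, §3.1 and §5; Knapp, Thm. 5.44. [cite: Clozel1990, §3.3] -/
def HasHCParameter (χ : (𝕜 →ₐ[ℝ] ℂ) → Multiset ℂ) : Prop :=
  (∀ τ, Multiset.card (χ τ) = n) ∧
    ∃ θ : Subalgebra.center ℝ (UniversalEnvelopingAlgebra ℝ (Matrix (Fin n) (Fin n) 𝕜)) →ₐ[ℝ] ℂ,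
      HasCentralCharacter ρ𝔤 θ ∧
        ∀ (γ : HarishChandraHomGL 𝕜 n) (l : (𝕜 →ₐ[ℝ] ℂ) → Fin n → ℂ),
          (∀ τ, (Finset.univ.val.map (l τ)) = χ τ) →
            ∀ z, θ z = MvPolynomial.aeval (fun p : (𝕜 →ₐ[ℝ] ℂ) × Fin n ↦ l p.1 p.2)
              (γ.toAlgHom z)

/-- Each multiset of a Harish-Chandra parameter of a `𝔤𝔩ₙ(𝕜)`-module has `n` elements.
Clozel 1990, §3.3. [cite: Clozel1990, §3.3] -/
theorem card_eq_of_hasHCParameter {χ : (𝕜 →ₐ[ℝ] ℂ) → Multiset ℂ} (h : HasHCParameter ρ𝔤 χ)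
    (τ : 𝕜 →ₐ[ℝ] ℂ) : Multiset.card (χ τ) = n :=
  h.1 τ

/-- A module with a Harish-Chandra parameter has an infinitesimal character.
Knapp, §V.5; Clozel 1990, §3.3. [cite: Clozel1990, §3.3] -/
theorem exists_hasCentralCharacter_of_hasHCParameter {χ : (𝕜 →ₐ[ℝ] ℂ) → Multiset ℂ}
    (h : HasHCParameter ρ𝔤 χ) :
    ∃ θ : Subalgebra.center ℝ (UniversalEnvelopingAlgebra ℝ (Matrix (Fin n) (Fin n) 𝕜)) →ₐ[ℝ] ℂ,
      HasCentralCharacter ρ𝔤 θ :=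
  let ⟨θ, hθ, _⟩ := h.2
  ⟨θ, hθ⟩

variable (𝕜 n) in
/-- Sanity check: the trivial one-dimensional representation of `𝔤𝔩ₙ(𝕜)` (`ρ𝔤 = 0` on `V = ℂ`,
highest weight `0`) has Harish-Chandra parameter `ρ = ((n-1)/2, …, -(n-1)/2)` at every `τ`.
Knapp, *Lie Groups Beyond an Introduction*, §V.5, (5.43) and Thm. 5.44; Buzzard–Gee 2014, §5
(the trivial representation is `C`-algebraic, `L`-algebraic iff `n` is odd). [cite: BuzzardGee2014, §5 (the trivial representation is  C -al] -/
def hasHCParameter_trivial : Prop :=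
  HasHCParameter (0 : Matrix (Fin n) (Fin n) 𝕜 →ₗ⁅ℝ⁆ Module.End ℂ ℂ)
      (fun _ ↦ Finset.univ.val.map (rhoGL n))

end GLn

end Literature.NumberTheory.Automorphic
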